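import Literature.NumberTheory.LFunctions.BinaryThetaSeries
import Literature.NumberTheory.LFunctions.GaussianThetaLValueOne
import HarnessLib

/-!
# Weight-one theta `L`-series of the binary forms `y₁² + N y₂²` at `s = 1` as a limit of
# damped lattice sums

Topic `Literature/NumberTheory/LFunctions`, continuing `BinaryThetaSeries` (and generalising
`GaussianThetaLValueOne`, the case `N = 1`): for `N, M ≥ 1`, weights `u, v ∈ ℂ` and a
coefficient `Ψ : ℤ × ℤ → ℂ` periodic modulo `M`, the entire continuation
`Literature.NumberTheory.LFunctions.BinaryTheta.thetaLFunction N M u v Ψ` of the Dirichlet series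
`∑_{y ≠ 0} Ψ(y) w(y) Q(y)^{-s}` (`Q(y) = y₁² + N y₂²`, `w(y) = u y₁ + v y₂`; absolutely convergent
only for `Re s > 3/2`) satisfies, **at the point `s = 1`** (the centre of the critical strip of
the weight-one Hecke `L`-series `L(ψ̄, s)` of an imaginary quadratic field, and the point where the
Eisenstein numbers `E₁(v; L)` of Rubin, LNM 1716 Def. 7.11 / Prop. 7.15 live):

* `thetaLFunction_one` — `L(1) = (π/M) ∫₀^∞ θ(t) dt`, the theta function
  `θ(t) = ∑_y Ψ(y) w(y) e^{-π t Q(y)/M}` being integrable on `(0, ∞)` (`integrableOn_theta`: it is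
  `O(t^{-b})` at `0⁺` and `O(t^{-A})` at `∞` for all `A, b`);
* `hasSum_setIntegral_Ioi_theta` — for `y > 0`,
  `∫_y^∞ θ(t) dt = (M/π) ∑_y Ψ(y) (w(y)/Q(y)) e^{-π y Q(y)/M}` (termwise integration, absolutely
  justified on `[y, ∞)`);
* `tendsto_tsum_thetaLFunction_one` —
  **`L(1) = lim_{t → 0⁺} ∑_{y ∈ ℤ × ℤ} Ψ(y) (w(y) / Q(y)) e^{-t Q(y)}`**: the value at `1` is the
  Abel–Gauss regularisation of the formal (at best conditionally convergent) lattice sum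
  `∑ Ψ(y) w(y)/Q(y)` — for `w(y) = y₁ + y₂√-N`, `Q(y) = |w(y)|²`, the sum `∑ Ψ/w̄`.

This is the first step of the evaluation of `L(ψ̄, 1)` and of the partial values
`∑_{β ≡ α (𝔪)} β̄ |β|^{-2s} |_{s=1}` as Eisenstein–Kronecker numbers (Rubin, LNM 1716, Def. 7.11,
Prop. 7.12, Prop. 7.15: `E₁(v; L) = v⁻¹ ψ(𝔠) L_𝔪(ψ̄, 1, 𝔠)`), carried out for `ℚ(i)` in the tree's
Gaussian-lattice cluster (`GaussianLatticeHeckeLValue.thetaLFunction_one_eq_sum_kroneckerE₁`).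
Everything here is proved; no named facts are introduced.

## Proof

As in `GaussianThetaLValueOne`: `θ` is continuous on `(0, ∞)` with the two-sided decay of
`BinaryThetaSeries`, so Mathlib's `mellinConvergent_of_isBigO_rpow` at `s = 1` gives
integrability, and `Γ(1) = 1` gives `thetaLFunction_one`. For `y > 0` the series
`∑ Ψ(y') w(y') e^{-π t Q(y')/M}` may be integrated termwise over `(y, ∞)`
(`MeasureTheory.hasSum_integral_of_summable_integral_norm`; the integrals of the norms are
`‖Ψ‖ ‖w‖ · M/(π Q) · e^{-π y Q/M} ≤ B (‖u‖ + ‖v‖) (M/π) e^{-π y Q/M}`, summable by comparison with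
`∑ Q^{-2}`), and `∫_y^∞ e^{-π t Q/M} dt = (M/(π Q)) e^{-π y Q/M}`. Finally `∫_y^∞ θ → ∫₀^∞ θ` as
`y → 0⁺` by dominated convergence, and the change of variable `y ↦ M y/π` removes the
normalisation of the exponent.

## References

* K. Rubin, *Elliptic curves with complex multiplication and the conjecture of Birch and
  Swinnerton-Dyer*, in: Arithmetic Theory of Elliptic Curves (Cetraro 1997), LNM 1716 (1999),
  §7.4, Def. 7.11, Prop. 7.12, Prop. 7.15 (held: `book:coates1999-arithmetic-theory-elliptic-curves`,
  pp. 244–245). [Rubin1999]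
* B. J. Birch, H. P. F. Swinnerton-Dyer, *Notes on elliptic curves. II*, J. reine angew. Math.
  218 (1965) 79–108, §3.
-/

noncomputable section

open Complex Real Set Filter Topology Asymptotics MeasureTheory

namespace Literature.NumberTheory.LFunctions

namespace BinaryTheta

variable (N : ℕ) [NeZero N]

/-! ### Gaussian sums over the form `Q_N` converge -/

/-- **`∑_{y ∈ ℤ × ℤ} e^{-c Q_N(y)}` converges for `c > 0`** (comparison with `∑_{y ≠ 0} Q_N(y)^{-2}`,
`summable_qf_rpow_neg`, through `e^{-u} ≤ 2/u²`). [folklore] -/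
theorem summable_exp_neg_mul_qf {c : ℝ} (hc : 0 < c) :
    Summable fun y : ℤ × ℤ ↦ rexp (-c * ((qf N y : ℤ) : ℝ)) := by
  let g : ℤ × ℤ → ℝ := fun y ↦
    2 / c ^ 2 * (((qf N y : ℤ) : ℝ)) ^ (-(2 : ℝ)) + if y = 0 then 1 else 0
  have hg : Summable g :=
    ((summable_qf_rpow_neg N (r := 2) (by norm_num)).mul_left (2 / c ^ 2)).add
      (summable_of_ne_finset_zero (s := {0}) (by
        intro y hy
        rw [Finset.mem_singleton] at hy
        exact if_neg hy))
  refine Summable.of_nonneg_of_le (fun y ↦ (Real.exp_pos _).le) (fun y ↦ ?_) hg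
  rcases eq_or_ne y 0 with rfl | hy
  · have h0 : ((qf N (0 : ℤ × ℤ) : ℤ) : ℝ) = 0 := by simp [qf]
    simp only [g, h0, mul_zero, Real.exp_zero, if_true,
      Real.zero_rpow (by norm_num : (-(2 : ℝ)) ≠ 0)]
    norm_num
  · have hQ : (0 : ℝ) < ((qf N y : ℤ) : ℝ) := by
      have h1 := qf_nonneg N y
      have h2 : qf N y ≠ 0 := fun h ↦ hy ((qf_eq_zero_iff N y).mp h)
      exact_mod_cast lt_of_le_of_ne h1 (Ne.symm h2)
    have hle := GaussianTheta.exp_neg_le_two_div_sq (mul_pos hc hQ)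
    simp only [g, if_neg hy, add_zero]
    rw [Real.rpow_neg hQ.le, Real.rpow_two, neg_mul]
    calc rexp (-(c * ((qf N y : ℤ) : ℝ))) ≤ 2 / (c * ((qf N y : ℤ) : ℝ)) ^ 2 := hle
      _ = 2 / c ^ 2 * (((qf N y : ℤ) : ℝ) ^ 2)⁻¹ := by
          rw [mul_pow]
          field_simp

variable (M : ℕ) [NeZero M] (u v : ℂ) (Ψ : ℤ × ℤ → ℂ)

/-! ### `θ` is integrable on `(0, ∞)`; the value of the continuation at `s = 1` -/

/-- **`θ` is integrable on `(0, ∞)`**: it is continuous there, `O(t^{-2})` at `∞` and `O(1)` at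
`0⁺` (`BinaryThetaSeries`), so the Mellin integral converges at `s = 1`. [folklore] -/
theorem integrableOn_theta : IntegrableOn (theta N M u v Ψ) (Ioi 0) := by
  have h : MellinConvergent (theta N M u v Ψ) 1 :=
    mellinConvergent_of_isBigO_rpow (a := 2) (b := 0)
      ((continuousOn_theta N M u v Ψ).locallyIntegrableOn measurableSet_Ioi)
      (isBigO_atTop_theta N M u v Ψ 2) (by simp only [Complex.one_re]; norm_num)
      (isBigO_nhdsGT_theta N M u v Ψ 0) (by simp only [Complex.one_re]; norm_num)
  refine IntegrableOn.congr_fun h (fun t _ ↦ ?_) measurableSet_Ioi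
  simp only [sub_self, Complex.cpow_zero, one_smul]

omit [NeZero N] in
/-- The Mellin transform of `θ` at `s = 1` is `∫₀^∞ θ(t) dt`. [folklore] -/
theorem mellin_theta_one :
    mellin (theta N M u v Ψ) 1 = ∫ t in Ioi (0 : ℝ), theta N M u v Ψ t := by
  unfold mellin
  refine setIntegral_congr_fun measurableSet_Ioi (fun t _ ↦ ?_)
  simp only [sub_self, Complex.cpow_zero, one_smul]

omit [NeZero N] in
/-- **`L(1) = (π/M) ∫₀^∞ θ(t) dt`** (`thetaLFunction` at `s = 1`; `Γ(1) = 1`). [folklore] -/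
theorem thetaLFunction_one :
    thetaLFunction N M u v Ψ 1 =
      (π : ℂ) / (M : ℂ) * ∫ t in Ioi (0 : ℝ), theta N M u v Ψ t := by
  unfold thetaLFunction
  rw [mellin_theta_one, Complex.Gamma_one, Complex.cpow_one, Complex.cpow_neg_one, inv_one,
    mul_one, div_eq_mul_inv]

/-! ### Termwise integration on `[y, ∞)` -/

variable {N M u v Ψ}

omit [NeZero N] [NeZero M] in
/-- The exponent of `thetaTerm`: `-π t Q(y)/M = (-(π Q(y)/M)) · t`. [folklore] -/
theorem thetaTerm_eq (t : ℝ) (y : ℤ × ℤ) :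
    thetaTerm N M u v Ψ t y = Ψ y * wt u v y *
      ((rexp (-(π * ((qf N y : ℤ) : ℝ) / M) * t) : ℝ) : ℂ) := by
  simp only [thetaTerm]
  congr 3
  ring

/-- For `y ≠ 0`, `Q_N(y) > 0` in `ℝ`. [folklore] -/
theorem qf_pos {y : ℤ × ℤ} (hy : y ≠ 0) : (0 : ℝ) < ((qf N y : ℤ) : ℝ) := by
  have h1 := qf_nonneg N y
  have h2 : qf N y ≠ 0 := fun h ↦ hy ((qf_eq_zero_iff N y).mp h)
  exact_mod_cast lt_of_le_of_ne h1 (Ne.symm h2)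

/-- For `y ≠ 0`, `Q_N(y) ≥ 1` in `ℝ`. [folklore] -/
theorem one_le_qf {y : ℤ × ℤ} (hy : y ≠ 0) : (1 : ℝ) ≤ ((qf N y : ℤ) : ℝ) := by
  have h1 := qf_nonneg N y
  have h2 : qf N y ≠ 0 := fun h ↦ hy ((qf_eq_zero_iff N y).mp h)
  have h3 : (1 : ℤ) ≤ qf N y := by omega
  exact_mod_cast h3

/-- For `y ≠ 0` the rate `π Q(y)/M` is positive. [folklore] -/
theorem rate_pos {y : ℤ × ℤ} (hy : y ≠ 0) : 0 < π * ((qf N y : ℤ) : ℝ) / M := by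
  have hM : (0 : ℝ) < M := by exact_mod_cast Nat.pos_of_ne_zero (NeZero.ne M)
  have hQ := qf_pos (N := N) hy
  positivity

/-- Each term `t ↦ Ψ(y) w(y) e^{-π t Q(y)/M}` is integrable on `(y₀, ∞)`. [folklore] -/
theorem integrableOn_thetaTerm (y₀ : ℝ) (y : ℤ × ℤ) :
    IntegrableOn (fun t ↦ thetaTerm N M u v Ψ t y) (Ioi y₀) := by
  rcases eq_or_ne y 0 with rfl | hy
  · have : (fun t ↦ thetaTerm N M u v Ψ t 0) = fun _ ↦ 0 := by
      funext t; simp [thetaTerm]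
    rw [this]
    exact integrableOn_zero
  · simp_rw [thetaTerm_eq]
    have h := (integrableOn_exp_mul_Ioi (by linarith [rate_pos (N := N) (M := M) hy] :
      -(π * ((qf N y : ℤ) : ℝ) / M) < 0) y₀).ofReal (𝕜 := ℂ)
    exact h.const_mul _

/-- **`∫_{y₀}^∞ Ψ(y) w(y) e^{-π t Q(y)/M} dt = (M/π) Ψ(y) (w(y)/Q(y)) e^{-π y₀ Q(y)/M}`** (for
`y = 0` both sides vanish). [folklore] -/
theorem integral_Ioi_thetaTerm (y₀ : ℝ) (y : ℤ × ℤ) :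
    ∫ t in Ioi y₀, thetaTerm N M u v Ψ t y =
      (M : ℂ) / π * (Ψ y * wt u v y / ((qf N y : ℤ) : ℂ) *
        ((rexp (-(π * ((qf N y : ℤ) : ℝ) / M) * y₀) : ℝ) : ℂ)) := by
  rcases eq_or_ne y 0 with rfl | hy
  · simp [thetaTerm]
  · have ha := rate_pos (N := N) (M := M) hy
    have hQ : ((qf N y : ℤ) : ℂ) ≠ 0 := by exact_mod_cast (qf_pos (N := N) hy).ne'
    have hπ : (π : ℂ) ≠ 0 := Complex.ofReal_ne_zero.mpr Real.pi_ne_zero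
    have hMc : (M : ℂ) ≠ 0 := Nat.cast_ne_zero.mpr (NeZero.ne M)
    simp_rw [thetaTerm_eq]
    rw [integral_const_mul, integral_complex_ofReal, GaussianTheta.integral_Ioi_exp_neg_mul ha y₀]
    push_cast
    field_simp

/-- **The norms integrate to `‖Ψ(y)‖ ‖w(y)‖ (M/(π Q(y))) e^{-π y₀ Q(y)/M}`** (`y ≠ 0`).
[folklore] -/
theorem integral_Ioi_norm_thetaTerm (y₀ : ℝ) {y : ℤ × ℤ} (hy : y ≠ 0) :
    ∫ t in Ioi y₀, ‖thetaTerm N M u v Ψ t y‖ =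
      ‖Ψ y‖ * ‖wt u v y‖ * (rexp (-(π * ((qf N y : ℤ) : ℝ) / M) * y₀) /
        (π * ((qf N y : ℤ) : ℝ) / M)) := by
  have ha := rate_pos (N := N) (M := M) hy
  have hnorm : ∀ t, ‖thetaTerm N M u v Ψ t y‖ =
      ‖Ψ y‖ * ‖wt u v y‖ * rexp (-(π * ((qf N y : ℤ) : ℝ) / M) * t) := by
    intro t
    rw [thetaTerm_eq, norm_mul, norm_mul, Complex.norm_real, Real.norm_eq_abs,
      abs_of_pos (Real.exp_pos _)]
  simp_rw [hnorm]
  rw [integral_const_mul, GaussianTheta.integral_Ioi_exp_neg_mul ha y₀]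

/-- The integrals of the norms are summable over `y ∈ ℤ × ℤ` (bounded by a Gaussian sum, using
`‖w(y)‖ ≤ (‖u‖ + ‖v‖) Q(y)^{1/2} ≤ (‖u‖ + ‖v‖) Q(y)`). [folklore] -/
theorem summable_integral_Ioi_norm_thetaTerm
    (hΨ : ∀ y z : ℤ × ℤ, Ψ (y.1 + M * z.1, y.2 + M * z.2) = Ψ y) {y₀ : ℝ} (hy₀ : 0 < y₀) :
    Summable fun y : ℤ × ℤ ↦ ∫ t in Ioi y₀, ‖thetaTerm N M u v Ψ t y‖ := by
  have hM : (0 : ℝ) < M := by exact_mod_cast Nat.pos_of_ne_zero (NeZero.ne M)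
  set B : ℝ := ∑ c : ZMod M × ZMod M, ‖Ψ (rep M c 0)‖ with hB
  have hB0 : 0 ≤ B := Finset.sum_nonneg fun _ _ ↦ norm_nonneg _
  have hc : 0 < π / M * y₀ := by positivity
  have hdom := (summable_exp_neg_mul_qf N hc).mul_left (B * (‖u‖ + ‖v‖) * (M / π))
  refine Summable.of_nonneg_of_le (fun y ↦ integral_nonneg fun t ↦ norm_nonneg _)
    (fun y ↦ ?_) hdom
  rcases eq_or_ne y 0 with rfl | hy
  · have : (fun t ↦ ‖thetaTerm N M u v Ψ t 0‖) = fun _ ↦ 0 := by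
      funext t; simp [thetaTerm]
    rw [this, integral_zero]
    exact mul_nonneg (mul_nonneg (mul_nonneg hB0 (by positivity)) (by positivity))
      (Real.exp_pos _).le
  · rw [integral_Ioi_norm_thetaTerm y₀ hy]
    have hQ1 : (1 : ℝ) ≤ ((qf N y : ℤ) : ℝ) := one_le_qf (N := N) hy
    have hQ : (0 : ℝ) < ((qf N y : ℤ) : ℝ) := by linarith
    have huv : 0 ≤ ‖u‖ + ‖v‖ := by positivity
    have hwn : ‖wt u v y‖ ≤ (‖u‖ + ‖v‖) * ((qf N y : ℤ) : ℝ) := by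
      calc ‖wt u v y‖ ≤ (‖u‖ + ‖v‖) * (((qf N y : ℤ) : ℝ)) ^ (1 / 2 : ℝ) := norm_wt_le N u v y
        _ ≤ (‖u‖ + ‖v‖) * (((qf N y : ℤ) : ℝ)) ^ (1 : ℝ) :=
            mul_le_mul_of_nonneg_left
              (Real.rpow_le_rpow_of_exponent_le hQ1 (by norm_num)) huv
        _ = (‖u‖ + ‖v‖) * ((qf N y : ℤ) : ℝ) := by rw [Real.rpow_one]
    have hexp : rexp (-(π * ((qf N y : ℤ) : ℝ) / M) * y₀) =
        rexp (-(π / M * y₀) * ((qf N y : ℤ) : ℝ)) := by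
      congr 1; ring
    rw [hexp]
    have hΨy : ‖Ψ y‖ ≤ B := norm_le_of_periodic M Ψ hΨ y
    have hE := (Real.exp_pos (-(π / M * y₀) * ((qf N y : ℤ) : ℝ))).le
    calc ‖Ψ y‖ * ‖wt u v y‖ * (rexp (-(π / M * y₀) * ((qf N y : ℤ) : ℝ)) /
          (π * ((qf N y : ℤ) : ℝ) / M))
        = ‖Ψ y‖ * (‖wt u v y‖ / ((qf N y : ℤ) : ℝ)) * (M / π) *
            rexp (-(π / M * y₀) * ((qf N y : ℤ) : ℝ)) := by
          field_simp
      _ ≤ B * (‖u‖ + ‖v‖) * (M / π) * rexp (-(π / M * y₀) * ((qf N y : ℤ) : ℝ)) := by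
          gcongr
          rw [div_le_iff₀ hQ]
          exact hwn

/-- **Termwise integration on `[y₀, ∞)`**: for `Ψ` periodic modulo `M` and `y₀ > 0`,
`∫_{y₀}^∞ θ(t) dt = (M/π) ∑_{y} Ψ(y) (w(y)/Q(y)) e^{-π y₀ Q(y)/M}` (absolutely convergent).
[folklore] -/
theorem hasSum_setIntegral_Ioi_theta
    (hΨ : ∀ y z : ℤ × ℤ, Ψ (y.1 + M * z.1, y.2 + M * z.2) = Ψ y) {y₀ : ℝ} (hy₀ : 0 < y₀) :
    HasSum (fun y : ℤ × ℤ ↦ (M : ℂ) / π * (Ψ y * wt u v y / ((qf N y : ℤ) : ℂ) *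
      ((rexp (-(π * ((qf N y : ℤ) : ℝ) / M) * y₀) : ℝ) : ℂ)))
      (∫ t in Ioi y₀, theta N M u v Ψ t) := by
  have hint : ∀ y : ℤ × ℤ,
      Integrable (fun t ↦ thetaTerm N M u v Ψ t y) (volume.restrict (Ioi y₀)) :=
    fun y ↦ integrableOn_thetaTerm y₀ y
  have h := hasSum_integral_of_summable_integral_norm hint
    (summable_integral_Ioi_norm_thetaTerm hΨ hy₀)
  have heq : ∫ t in Ioi y₀, (∑' y : ℤ × ℤ, thetaTerm N M u v Ψ t y) =
      ∫ t in Ioi y₀, theta N M u v Ψ t := by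
    refine setIntegral_congr_fun measurableSet_Ioi (fun t ht ↦ ?_)
    exact (hasSum_theta N M u v Ψ hΨ (hy₀.trans ht)).tsum_eq
  rw [heq] at h
  refine h.congr_fun fun y ↦ ?_
  exact (integral_Ioi_thetaTerm y₀ y).symm

/-! ### The limit `y₀ → 0⁺` -/

variable (N M u v Ψ)

/-- `∫_{y₀}^∞ θ → ∫₀^∞ θ` as `y₀ → 0⁺` (dominated convergence, `θ` integrable on `(0, ∞)`).
[folklore] -/
theorem tendsto_setIntegral_Ioi_theta :
    Tendsto (fun y₀ : ℝ ↦ ∫ t in Ioi y₀, theta N M u v Ψ t) (𝓝[>] 0)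
      (𝓝 (∫ t in Ioi (0 : ℝ), theta N M u v Ψ t)) := by
  have hθ := integrableOn_theta N M u v Ψ
  have hlim : Tendsto (fun y₀ : ℝ ↦ ∫ t in Ioi (0 : ℝ), (Ioi y₀).indicator (theta N M u v Ψ) t)
      (𝓝[>] 0) (𝓝 (∫ t in Ioi (0 : ℝ), theta N M u v Ψ t)) := by
    refine tendsto_integral_filter_of_dominated_convergence (fun t ↦ ‖theta N M u v Ψ t‖)
      (Eventually.of_forall fun y₀ ↦
        hθ.aestronglyMeasurable.indicator measurableSet_Ioi)
      (Eventually.of_forall fun y₀ ↦ ae_of_all _ fun t ↦ norm_indicator_le_norm_self _ _)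
      hθ.norm ?_
    refine (ae_restrict_iff' measurableSet_Ioi).2 (ae_of_all _ fun t (ht : 0 < t) ↦ ?_)
    have hev : ∀ᶠ y₀ : ℝ in 𝓝[>] 0,
        (Ioi y₀).indicator (theta N M u v Ψ) t = theta N M u v Ψ t := by
      have h1 : ∀ᶠ y₀ : ℝ in 𝓝[>] 0, y₀ < t := nhdsWithin_le_nhds (Iio_mem_nhds ht)
      filter_upwards [h1] with y₀ hy₀
      exact indicator_of_mem (mem_Ioi.mpr hy₀) _
    exact tendsto_const_nhds.congr' (hev.mono fun y₀ hy₀ ↦ hy₀.symm)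
  refine hlim.congr' ?_
  filter_upwards [self_mem_nhdsWithin] with y₀ (hy₀ : 0 < y₀)
  rw [setIntegral_indicator measurableSet_Ioi, Ioi_inter_Ioi, sup_eq_right.mpr hy₀.le]

/-- **`L(1) = lim_{y₀ → 0⁺} ∑_y Ψ(y) (w(y)/Q(y)) e^{-π y₀ Q(y)/M}`** (normalised exponent).
[folklore] -/
theorem tendsto_tsum_thetaLFunction_one'
    (hΨ : ∀ y z : ℤ × ℤ, Ψ (y.1 + M * z.1, y.2 + M * z.2) = Ψ y) :
    Tendsto (fun y₀ : ℝ ↦ ∑' y : ℤ × ℤ, Ψ y * wt u v y / ((qf N y : ℤ) : ℂ) *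
      ((rexp (-(π * ((qf N y : ℤ) : ℝ) / M) * y₀) : ℝ) : ℂ)) (𝓝[>] 0)
      (𝓝 (thetaLFunction N M u v Ψ 1)) := by
  have hπ : (π : ℂ) ≠ 0 := Complex.ofReal_ne_zero.mpr Real.pi_ne_zero
  have hMc : (M : ℂ) ≠ 0 := Nat.cast_ne_zero.mpr (NeZero.ne M)
  have h1 := (tendsto_setIntegral_Ioi_theta N M u v Ψ).const_mul ((π : ℂ) / M)
  rw [← thetaLFunction_one] at h1
  refine h1.congr' ?_
  filter_upwards [self_mem_nhdsWithin] with y₀ (hy₀ : 0 < y₀)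
  rw [← (hasSum_setIntegral_Ioi_theta hΨ hy₀).tsum_eq, ← tsum_mul_left]
  refine tsum_congr fun y ↦ ?_
  field_simp

/-- **The value at `s = 1` as a limit of Gaussian-damped lattice sums**: for `Ψ : ℤ × ℤ → ℂ`
periodic modulo `M ≥ 1`, weights `u, v` and `N ≥ 1`,
`thetaLFunction N M u v Ψ 1 = lim_{t → 0⁺} ∑_{y ∈ ℤ × ℤ} Ψ(y) (w(y)/Q(y)) e^{-t Q(y)}`.
With `w(y) = y₁ + y₂ √-N` (`u = 1`, `v = √-N`) one has `Q(y) = |w(y)|²` and the summand is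
`Ψ(y) e^{-t|w|²}/w̄`, the Eisenstein–Kronecker regularisation of the weight-one partial Hecke
`L`-values at `s = 1` (Rubin, LNM 1716, Def. 7.11 and Prop. 7.15 with `k = 1`).
[cite: Rubin1999, §7.4 Def. 7.11 and Prop. 7.15 (LNM 1716 pp. 244–245)] -/
theorem tendsto_tsum_thetaLFunction_one
    (hΨ : ∀ y z : ℤ × ℤ, Ψ (y.1 + M * z.1, y.2 + M * z.2) = Ψ y) :
    Tendsto (fun t : ℝ ↦ ∑' y : ℤ × ℤ, Ψ y * wt u v y / ((qf N y : ℤ) : ℂ) *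
      ((rexp (-t * ((qf N y : ℤ) : ℝ)) : ℝ) : ℂ)) (𝓝[>] 0)
      (𝓝 (thetaLFunction N M u v Ψ 1)) := by
  have hM : (0 : ℝ) < M := by exact_mod_cast Nat.pos_of_ne_zero (NeZero.ne M)
  have h := (tendsto_tsum_thetaLFunction_one' N M u v Ψ hΨ).comp
    (GaussianTheta.tendsto_const_mul_nhdsGT_zero (c := M / π) (by positivity))
  refine h.congr fun t ↦ ?_
  simp only [Function.comp_apply]
  refine tsum_congr fun y ↦ ?_
  congr 3
  field_simp

end BinaryTheta

end Literature.NumberTheory.LFunctions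

end
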